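import Summits.ResolutionOfSingularities.ResolutionOfSingularities.Theorems.FrobeniusLadderFInjectiveMacaulayficationPointCentreOfCertifiedCharts
import Literature.AlgebraicGeometry.Resolution.AffineBlowupUniversal
import Literature.AlgebraicGeometry.Resolution.BlowupsLocal
import Literature.AlgebraicGeometry.Resolution.ExceptionalDivisorProjectiveBundle
import HarnessLib

/-!
# T-𝒫-loc core — stalks of blowing ups over affine charts and a point-centre from the LOCAL blow-up clause
(crux `FInjectiveMacaulayfication`, chain w45a)

Support file for crux stmt-ResolutionOfSingularities-15315 (`FrobeniusLadder.FInjectiveMacaulayfication`), chain w45a, seat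
res-L1-w45a-stub-1 (RULING R11.2 of res-L1-w45a-plan-1, 2026-08-27: §5 «T-𝒫-loc» pieces 5a/5b/5d of `L/w45a/ClassGlueSig.lean`).
[OURS · L1 W4.5a] — NOT a statement of the manuscript under review; AI-written, weaker than expert review.

The LOCALLY-FIXABLE class `P_loc X₁ f₁ b` replaces the E6‴ certificate block of the certified-chart class `P_cert`
(`CertifiedChartCentre`, `CertifiedChartTransport`) by the LOCAL BLOW-UP CLAUSE: an affine chart `U ∋ b` with an ideal
`I ≠ 0 ⊆ Γ(X₁, U)` of zero locus `{b}` such that every stalk of the affine blowing up `Bl_I(U) = affineBlowup I` at a point over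
`b` is a domain, Cohen–Macaulay, with Frobenius-closed parameter ideals (the «full clause», inline text of the crux). This file
holds the statement-independent engine:

* `exists_stalk_ringEquiv_over` — for ANY blowing up `π : X' ⟶ X₁` along an ideal sheaf `J` and an affine open `U`, the stalk
  of `X'` at a point `x` over `U` is a stalk of `affineBlowup (J(U))` at a point over the SAME base point `π x`
  (`IsBlowup.exists_chartImmersion`);
* `exists_stalk_ringEquiv_of_isBlowup_idealSheaf` — stalks of any blowing up of `Spec R` along `Ĩ` are stalks of `Bl_I(Spec R)`
  over the same point (`IsBlowup.unique`);
* `exists_stalk_ringEquiv_of_bijective` — `Bl_{φ(I)}(Spec R')` versus `Bl_I(Spec R)` for a bijective ring map `φ`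
  (`comap_idealSheaf_specMap`, `IsBlowup.comp_iso`, uniqueness);
* `pointCentre_of_localBlowupClause` — the certificate-free §2b: from the local blow-up clause over `b`, the point-centre ideal
  sheaf `J` of `I` (`PointCentreIdealSheaf.stub_pointCentreIdealSheaf`, `supp J = {b}`) has ALL its blowing ups satisfying the
  full clause over `b`;
* `affineBlowupClause_transport` — the local blow-up clause moves along `π` over a chart `U` with `π⁻¹U` affine and `π^*`
  bijective (naturality `Spec(π^*) ≫ (U → X₁) = (π⁻¹U → X') ≫ π`, `IsAffineOpen.SpecMap_appLE_fromSpec`);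
* `clauseOff_of_zeroLocus` — the full clause off `b` on `U`, read at the primes `P ⊉ I` of `Γ(X₁, U)`.

No definitions, no named facts, no `sorry`. [folklore]
-/

-- single-problem summit: the doubled namespace component is forced
set_option linter.dupNamespace false

noncomputable section

namespace Summit.ResolutionOfSingularities.ResolutionOfSingularities.Theorems.FInjectiveMacaulayfication.LocallyFixable

open AlgebraicGeometry CategoryTheory Literature.AlgebraicGeometry.Resolution TopologicalSpace
open Summit.ResolutionOfSingularities.ResolutionOfSingularities.Theorems.FInjectiveMacaulayfication

/-! ## §0 Stalks of blowing ups over affine opens; transport of affine blowing ups along ring isomorphisms -/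

/-- **Stalks of a blowing up over an affine open, with the base point** (`BlowupStalkOverAffine.stub_blowupStalkOverAffine` plus the
compatibility `φ ≫ π = affineBlowup.π ≫ fromSpec` of `IsBlowup.exists_chartImmersion`): every stalk of `X'` at a point `x` over `U` is
ring-isomorphic to the stalk of `affineBlowup (J.ideal U)` at a point lying over the SAME point `π x`. [cite: GortzWedhorn2020, Prop. 13.91] -/
theorem exists_stalk_ringEquiv_over (X₁ X' : Scheme.{0}) (J : X₁.IdealSheafData) (π : X' ⟶ X₁)
    (hπ : IsBlowup π J) (U : X₁.affineOpens) (x : X') (hx : π.base x ∈ (U : X₁.Opens)) :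
    ∃ y : ↥(affineBlowup (J.ideal U)),
      (affineBlowup.π (J.ideal U) ≫ U.2.fromSpec).base y = π.base x ∧
      Nonempty (X'.presheaf.stalk x ≃+* (affineBlowup (J.ideal U)).presheaf.stalk y) := by
  obtain ⟨φ, hφ, hcomm, hrange⟩ := hπ.exists_chartImmersion U
  have hx' : x ∈ φ.opensRange := by
    rw [hrange]
    exact hx
  obtain ⟨y, rfl⟩ := hx'
  refine ⟨y, ?_, ⟨(asIso (φ.stalkMap y)).commRingCatIsoToRingEquiv⟩⟩
  rw [← hcomm]
  rfl

/-- **Stalks of ANY blowing up of `Spec R` along `Ĩ`** are stalks of the affine blowing up `Bl_I(Spec R)` at a point over the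
same point of `Spec R` (uniqueness of blowing ups up to isomorphism over the base, `IsBlowup.unique`). [cite: GortzWedhorn2020, (13.19) p. 413] -/
theorem exists_stalk_ringEquiv_of_isBlowup_idealSheaf {R : Type} [CommRing R] (I : Ideal R) {X'' : Scheme.{0}}
    (ρ : X'' ⟶ Spec (.of R)) (hρ : IsBlowup ρ (affineBlowup.idealSheaf I)) (y'' : X'') :
    ∃ y : ↥(affineBlowup I), (affineBlowup.π I).base y = ρ.base y'' ∧
      Nonempty (X''.presheaf.stalk y'' ≃+* (affineBlowup I).presheaf.stalk y) := by
  obtain ⟨ε, -, hε₂⟩ := (affineBlowup.isBlowup I).unique hρ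
  refine ⟨ε.inv.base y'', ?_, ⟨(asIso (ε.inv.stalkMap y'')).commRingCatIsoToRingEquiv.symm⟩⟩
  change (ε.inv ≫ affineBlowup.π I).base y'' = _
  rw [hε₂]

/-- **Affine blowing ups along a ring isomorphism**: for a bijective ring map `φ : R → R'`, every stalk of `Bl_{φ(I)}(Spec R')`
at `y'` is a stalk of `Bl_I(Spec R)` at a point `y` with `π_I y = Spec(φ) (π_{φ(I)} y')` (`Spec φ` is an isomorphism carrying the
ideal sheaf of `φ(I)` to that of `I`, `comap_idealSheaf_specMap`; then `IsBlowup.comp_iso` + uniqueness). [folklore] -/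
theorem exists_stalk_ringEquiv_of_bijective {R R' : Type} [CommRing R] [CommRing R'] (φ : R →+* R')
    (hφ : Function.Bijective φ) (I : Ideal R) (y' : ↥(affineBlowup (I.map φ))) :
    ∃ y : ↥(affineBlowup I), (affineBlowup.π I).base y =
        (Spec.map (CommRingCat.ofHom φ)).base ((affineBlowup.π (I.map φ)).base y') ∧
      Nonempty ((affineBlowup (I.map φ)).presheaf.stalk y' ≃+* (affineBlowup I).presheaf.stalk y) := by
  classical
  let e : R ≃+* R' := RingEquiv.ofBijective φ hφ
  let ι : CommRingCat.of R ≅ CommRingCat.of R' := e.toCommRingCatIso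
  let E : Spec (.of R') ≅ Spec (.of R) := Scheme.Spec.mapIso ι.op
  have hEhom : E.hom = Spec.map (CommRingCat.ofHom φ) := rfl
  have hEinv : E.inv = Spec.map (CommRingCat.ofHom (e.symm : R' →+* R)) := rfl
  have h₁ := (affineBlowup.isBlowup (I.map φ)).comp_iso E
  rw [hEinv, comap_idealSheaf_specMap, Ideal.map_map,
    show (e.symm : R' →+* R).comp φ = RingHom.id R from RingHom.ext fun r => e.symm_apply_apply r,
    Ideal.map_id] at h₁
  obtain ⟨y, hy, he⟩ := exists_stalk_ringEquiv_of_isBlowup_idealSheaf I _ h₁ y'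
  exact ⟨y, by rw [hy, hEhom]; rfl, he⟩

/-- **A POINT-CENTRE FROM THE LOCAL BLOW-UP CLAUSE** (certificate-free §2b): `X₁` integral and locally Noetherian, `b` a closed point
of an affine open `U`, `I ≠ 0` an ideal of `Γ(X₁, U)` with zero locus `{b}`; if every stalk of the affine blowing up `affineBlowup I` at a
point over `b` satisfies the full clause, then the point-centre ideal sheaf `J` of `I` (`PointCentreIdealSheaf`, `supp J = {b}`) has ALL
its blowing ups satisfying the full clause over `b` (stalks over `U` of any blowing up along `J` are stalks of `affineBlowup (J(U))`
over the same point, `exists_stalk_ringEquiv_over`). [folklore] -/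
theorem pointCentre_of_localBlowupClause (p : ℕ) (X₁ : Scheme.{0}) [IsIntegral X₁] [IsLocallyNoetherian X₁]
    (b : X₁) (hb : IsClosed ({b} : Set X₁)) (U : X₁.affineOpens) (hbU : b ∈ (U : X₁.Opens))
    (I : Ideal Γ(X₁, U)) (hI0 : I ≠ ⊥)
    (hzero : ∀ (x : X₁) (hx : x ∈ (U : X₁.Opens)), I ≤ (U.2.primeIdealOf ⟨x, hx⟩).asIdeal ↔ x = b)
    (hgood : ∀ y : ↥(affineBlowup I), (affineBlowup.π I ≫ U.2.fromSpec).base y = b →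
      IsDomain ((affineBlowup I).presheaf.stalk y) ∧ ∀ d : ℕ, ringKrullDim ((affineBlowup I).presheaf.stalk y) = d →
        ∀ s : Fin d → (affineBlowup I).presheaf.stalk y, (Ideal.span (Set.range s)).radical.IsMaximal →
          RingTheory.Sequence.IsWeaklyRegular ((affineBlowup I).presheaf.stalk y) (List.ofFn s) ∧
          ∀ z : (affineBlowup I).presheaf.stalk y, (∃ e : ℕ, z ^ p ^ e ∈ Ideal.span
            ((fun w : (affineBlowup I).presheaf.stalk y => w ^ p ^ e) ''
              (Ideal.span (Set.range s) : Set ((affineBlowup I).presheaf.stalk y)))) → z ∈ Ideal.span (Set.range s)) :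
    ∃ J : X₁.IdealSheafData, J ≠ ⊥ ∧ (J.support : Set X₁) = {b} ∧
      ∀ (X' : Scheme.{0}) (π : X' ⟶ X₁), IsBlowup π J →
        ∀ x' : X', π.base x' = b → IsDomain (X'.presheaf.stalk x') ∧ ∀ d : ℕ, ringKrullDim (X'.presheaf.stalk x') = d →
          ∀ s : Fin d → X'.presheaf.stalk x', (Ideal.span (Set.range s)).radical.IsMaximal →
            RingTheory.Sequence.IsWeaklyRegular (X'.presheaf.stalk x') (List.ofFn s) ∧
            ∀ y : X'.presheaf.stalk x', (∃ e : ℕ, y ^ p ^ e ∈ Ideal.span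
              ((fun z : X'.presheaf.stalk x' => z ^ p ^ e) ''
                (Ideal.span (Set.range s) : Set (X'.presheaf.stalk x')))) → y ∈ Ideal.span (Set.range s) := by
  obtain ⟨J, hJU, hsupp, -⟩ := PointCentreIdealSheaf.stub_pointCentreIdealSheaf X₁ U I b hbU hb hzero
  subst hJU
  refine ⟨J, fun hbot => hI0 (by rw [hbot]; rfl), hsupp, fun X' π hπ x' hx' => ?_⟩
  obtain ⟨y, hy, ⟨e⟩⟩ := exists_stalk_ringEquiv_over X₁ X' J π hπ U x' (hx' ▸ hbU)
  exact fiClause_of_ringEquiv p e.symm (hgood y (hy.trans hx'))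

/-- **The local blow-up clause moves along `π` over a chart where `π^*` is bijective**: if `U' := π⁻¹U` is affine and
`π^* : Γ(X₁, U) → Γ(X', U')` bijective, and every stalk of `Bl_I(U)` over `π x'` satisfies the full clause, then every stalk of
`Bl_{π^* I}(U')` over `x'` does (`exists_stalk_ringEquiv_of_bijective` + the naturality square `Spec(π^*) ≫ (U → X₁) = (U' → X') ≫ π`,
`IsAffineOpen.SpecMap_appLE_fromSpec`). [folklore] -/
theorem affineBlowupClause_transport (p : ℕ) (X₁ X' : Scheme.{0}) (π : X' ⟶ X₁) (U : X₁.affineOpens)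
    (hU' : IsAffineOpen (π ⁻¹ᵁ (U : X₁.Opens))) (hφ : Function.Bijective (π.app (U : X₁.Opens)).hom)
    (I : Ideal Γ(X₁, U)) (x' : X')
    (hloc : ∀ y : ↥(affineBlowup I), (affineBlowup.π I ≫ U.2.fromSpec).base y = π.base x' →
      IsDomain ((affineBlowup I).presheaf.stalk y) ∧ ∀ d : ℕ, ringKrullDim ((affineBlowup I).presheaf.stalk y) = d →
        ∀ s : Fin d → (affineBlowup I).presheaf.stalk y, (Ideal.span (Set.range s)).radical.IsMaximal →
          RingTheory.Sequence.IsWeaklyRegular ((affineBlowup I).presheaf.stalk y) (List.ofFn s) ∧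
          ∀ z : (affineBlowup I).presheaf.stalk y, (∃ e : ℕ, z ^ p ^ e ∈ Ideal.span
            ((fun w : (affineBlowup I).presheaf.stalk y => w ^ p ^ e) ''
              (Ideal.span (Set.range s) : Set ((affineBlowup I).presheaf.stalk y)))) → z ∈ Ideal.span (Set.range s)) :
    ∀ y' : ↥(affineBlowup (I.map (π.app (U : X₁.Opens)).hom)),
      (affineBlowup.π (I.map (π.app (U : X₁.Opens)).hom) ≫ hU'.fromSpec).base y' = x' →
      IsDomain ((affineBlowup (I.map (π.app (U : X₁.Opens)).hom)).presheaf.stalk y') ∧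
        ∀ d : ℕ, ringKrullDim ((affineBlowup (I.map (π.app (U : X₁.Opens)).hom)).presheaf.stalk y') = d →
        ∀ s : Fin d → (affineBlowup (I.map (π.app (U : X₁.Opens)).hom)).presheaf.stalk y',
          (Ideal.span (Set.range s)).radical.IsMaximal →
          RingTheory.Sequence.IsWeaklyRegular ((affineBlowup (I.map (π.app (U : X₁.Opens)).hom)).presheaf.stalk y') (List.ofFn s) ∧
          ∀ z : (affineBlowup (I.map (π.app (U : X₁.Opens)).hom)).presheaf.stalk y', (∃ e : ℕ, z ^ p ^ e ∈ Ideal.span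
            ((fun w : (affineBlowup (I.map (π.app (U : X₁.Opens)).hom)).presheaf.stalk y' => w ^ p ^ e) ''
              (Ideal.span (Set.range s) : Set ((affineBlowup (I.map (π.app (U : X₁.Opens)).hom)).presheaf.stalk y')))) →
            z ∈ Ideal.span (Set.range s) := by
  intro y' hy'
  obtain ⟨y, hy, ⟨e⟩⟩ := exists_stalk_ringEquiv_of_bijective (π.app (U : X₁.Opens)).hom hφ I y'
  refine fiClause_of_ringEquiv p e.symm (hloc y ?_)
  have hnat := IsAffineOpen.SpecMap_appLE_fromSpec π U.2 hU' (le_refl _)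
  rw [Scheme.Hom.appLE_eq_app] at hnat
  calc (affineBlowup.π I ≫ U.2.fromSpec).base y
        = (Spec.map (π.app (U : X₁.Opens)) ≫ U.2.fromSpec).base
            ((affineBlowup.π (I.map (π.app (U : X₁.Opens)).hom)).base y') := by
          change U.2.fromSpec.base ((affineBlowup.π I).base y) = _
          rw [hy]
          rfl
    _ = (hU'.fromSpec ≫ π).base ((affineBlowup.π (I.map (π.app (U : X₁.Opens)).hom)).base y') := by rw [hnat]
    _ = π.base ((affineBlowup.π (I.map (π.app (U : X₁.Opens)).hom) ≫ hU'.fromSpec).base y') := rfl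
    _ = π.base x' := by rw [hy']

/-- **OFF THE ZERO LOCUS, SCHEME TO RING** (`ClauseOffCentre.stub_clauseOffCentre` for an ideal instead of an ideal sheaf): if
`I ⊆ Γ(X, U)` has zero locus `{b}` on the affine open `U` and the stalks of `X` at the points of `U` other than `b` satisfy the full
clause, then so does `Γ(X, U)_P` for every prime `P ⊉ I` (`x_P := U.fromSpec P ≠ b` since `𝔭_(x_P) = P ⊉ I`;
`𝒪_(X, x_P) ≃ Γ(X, U)_P`, `IsAffineOpen.isLocalization_stalk'`). [folklore] -/
theorem clauseOff_of_zeroLocus (p : ℕ) (X : Scheme.{0}) (U : X.affineOpens) (I : Ideal Γ(X, U)) (b : X)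
    (hzero : ∀ (x : X) (hx : x ∈ (U : X.Opens)), I ≤ (U.2.primeIdealOf ⟨x, hx⟩).asIdeal ↔ x = b)
    (h : ∀ x : X, x ∈ (U : X.Opens) → x ≠ b → IsDomain (X.presheaf.stalk x) ∧ ∀ d : ℕ, ringKrullDim (X.presheaf.stalk x) = d → ∀ s : Fin d → X.presheaf.stalk x, (Ideal.span (Set.range s)).radical.IsMaximal → RingTheory.Sequence.IsWeaklyRegular (X.presheaf.stalk x) (List.ofFn s) ∧ ∀ y : X.presheaf.stalk x, (∃ e : ℕ, y ^ p ^ e ∈ Ideal.span ((fun z : X.presheaf.stalk x => z ^ p ^ e) '' (Ideal.span (Set.range s) : Set (X.presheaf.stalk x)))) → y ∈ Ideal.span (Set.range s)) :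
    ∀ (P : Ideal Γ(X, U)) [P.IsPrime], ¬ I ≤ P → IsDomain (Localization.AtPrime P) ∧ ∀ d : ℕ, ringKrullDim (Localization.AtPrime P) = d → ∀ s : Fin d → Localization.AtPrime P, (Ideal.span (Set.range s)).radical.IsMaximal → RingTheory.Sequence.IsWeaklyRegular (Localization.AtPrime P) (List.ofFn s) ∧ ∀ y : Localization.AtPrime P, (∃ e : ℕ, y ^ p ^ e ∈ Ideal.span ((fun z : Localization.AtPrime P => z ^ p ^ e) '' (Ideal.span (Set.range s) : Set (Localization.AtPrime P)))) → y ∈ Ideal.span (Set.range s) := by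
  intro P hP hIP
  have hxU : U.2.fromSpec ⟨P, hP⟩ ∈ (U : X.Opens) := ClauseOffCentre.fromSpec_mem U ⟨P, hP⟩
  have hxb : U.2.fromSpec ⟨P, hP⟩ ≠ b := by
    intro hxb
    apply hIP
    have hle := (hzero _ hxU).mpr hxb
    rwa [PointCentreIdealSheaf.primeIdealOf_fromSpec U.2 ⟨P, hP⟩ hxU] at hle
  letI : Algebra Γ(X, U) (X.presheaf.stalk (U.2.fromSpec ⟨P, hP⟩)) :=
    TopCat.Presheaf.algebra_section_stalk X.presheaf ⟨U.2.fromSpec ⟨P, hP⟩, hxU⟩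
  haveI : IsLocalization.AtPrime (X.presheaf.stalk (U.2.fromSpec ⟨P, hP⟩)) P :=
    U.2.isLocalization_stalk' ⟨P, hP⟩ hxU
  exact fiClause_of_ringEquiv p (IsLocalization.algEquiv P.primeCompl
    (X.presheaf.stalk (U.2.fromSpec ⟨P, hP⟩)) (Localization.AtPrime P)).toRingEquiv (h _ hxU hxb)

end Summit.ResolutionOfSingularities.ResolutionOfSingularities.Theorems.FInjectiveMacaulayfication.LocallyFixable

end
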